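import Mathlib
import HarnessLib
import Summits.NavierStokesRegularity.NavierStokesRegularity.Theorems.TypeIQuarterGateScarEnvelopeTypeIForcedTsaiAlgSoundF
import Summits.NavierStokesRegularity.NavierStokesRegularity.Theorems.TypeIQuarterGateScarEnvelopeTypeIForcedTsaiAlgMomentsOdd

/-!
# ARM B lane E-exact, Type-I-tail class — SOUNDNESS of the v3 rows with the EXACT weight `(1+ρ)⁵`:
  `AlgRowG.checkG = true → ForcedTsaiModulusLE M δ` (LANEX-ALG v3, `…ForcedTsaiAlgCertG`)

New ingredient over `…AlgSoundF`: the residual currency is no longer MAJORISED but computed —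
`(1+ρ)⁵ = (1 + 10t + 5t²) + ρ·(5 + 10t + t²)` pointwise (`t = ρ² = |y|²`), so
`∫ (1+ρ)⁵|g|² = ∫ weightEven·|gNF|² + ∫ |y|·(weightOdd·|gNF|²) = (RE₁ + O)·π + RE₂·π²` EXACTLY, by the landed
even moment table (`integral_poly5`) and the odd radial moments (`integral_poly5_odd` of `…AlgMomentsOdd`);
the level side (certified polynomial floor) is that of `…AlgSoundF` verbatim.
UPPER bounds on the forced-Tsai modulus only («near-profiles this good exist»); excludes nothing; nothing about
NS regularity; 23843 / H3 OPEN.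
-/

noncomputable section

set_option linter.dupNamespace false

namespace Summit.NavierStokesRegularity.NavierStokesRegularity.Cruxes.ScarEnvelopeTypeI.ForcedTsai

open MeasureTheory Set Metric Real Finset
open scoped RealInnerProductSpace ContDiff
open Literature.Analysis.FluidPDE

/-! ## The exact weight split -/

/-- Value of the even weight `1 + 10t + 5t²`. -/
theorem eval_weightEven (τ : ℝ) (y : E3) :
    Poly5.eval τ weightEven y = 1 + 10 * ‖y‖ ^ 2 + 5 * (‖y‖ ^ 2) ^ 2 := by
  rw [weightEven]
  simp only [Poly5.eval_cons, Poly5.eval_nil, eval_tMono]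
  push_cast
  ring

/-- Value of the odd weight `5 + 10t + t²`. -/
theorem eval_weightOdd (τ : ℝ) (y : E3) :
    Poly5.eval τ weightOdd y = 5 + 10 * ‖y‖ ^ 2 + (‖y‖ ^ 2) ^ 2 := by
  rw [weightOdd]
  simp only [Poly5.eval_cons, Poly5.eval_nil, eval_tMono]
  push_cast
  ring

/-- **The exact split** `(1+|y|)⁵ = weightEven(y) + |y|·weightOdd(y)`. -/
theorem one_add_norm_pow_five (τ : ℝ) (y : E3) :
    (1 + ‖y‖) ^ 5 = Poly5.eval τ weightEven y + ‖y‖ * Poly5.eval τ weightOdd y := by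
  rw [eval_weightEven, eval_weightOdd]; ring

namespace AlgRowG

/-- The v2 view and the v1 view of a v3 row have the same witness data. -/
theorem toRowF_toRow (r : AlgRowG) : r.toRowF.toRow = r.toRow := rfl

/-- Value of `|gNF|²`: `‖g(y)‖²` for the vorticity residual `g` of the witness field (`τ ≠ 0`). -/
theorem eval_g2Poly (r : AlgRowG) (hτ : r.toRow.tauR ≠ 0) (y : E3) :
    Poly5.eval r.toRow.tauR r.g2Poly y = ‖lerayVorticityResidual r.toRow.field y‖ ^ 2 := by
  rw [AlgRowG.g2Poly, r.toRow.vorticityResidual_field_nf hτ y, AlgRow.norm_sq_evalVec5]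

/-- **The v3 residual identity (pointwise)**:
`(1+|y|)⁵‖g(y)‖² = resPolyE(y) + |y|·resPolyO(y)`. -/
theorem weight_mul_residual_eq (r : AlgRowG) (hτ : r.toRow.tauR ≠ 0) (y : E3) :
    (1 + ‖y‖) ^ 5 * ‖lerayVorticityResidual r.toRow.field y‖ ^ 2 =
      Poly5.eval r.toRow.tauR r.resPolyE y + ‖y‖ * Poly5.eval r.toRow.tauR r.resPolyO y := by
  rw [AlgRowG.resPolyE, AlgRowG.resPolyO, Poly5.eval_nmul, Poly5.eval_nmul, r.eval_g2Poly hτ y,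
    one_add_norm_pow_five r.toRow.tauR y]
  ring

/-- **SOUNDNESS of a v3 row (certified polynomial floor, exact weight)**: a passing row certifies
`ForcedTsaiModulusLE M δ` — an upper bound on the forced-Tsai modulus. -/
theorem sound (r : AlgRowG) (h : r.checkG = true) :
    ForcedTsaiModulusLE (r.M : ℝ) (r.δ : ℝ) := by
  unfold AlgRowG.checkG at h
  rcases hL : r.toRowF.lev2F with _ | L <;> rcases hE : r.res2E with _ | R <;> rcases hO : r.res2O with _ | o <;>
    simp only [hL, hE, hO, Bool.and_false, Bool.and_eq_true, decide_eq_true_eq, Bool.false_eq_true] at h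
  obtain ⟨⟨⟨⟨hτ, hM⟩, hδ⟩, hfloor⟩, hlev, hres⟩ := h
  have hτR : 0 < r.toRow.tauR := by unfold AlgRow.tauR AlgRowG.toRow; exact_mod_cast hτ
  have hτ0 : r.toRow.tauR ≠ 0 := hτR.ne'
  have hM' : (0 : ℝ) ≤ r.M := by exact_mod_cast hM
  have hδ' : (0 : ℝ) ≤ r.δ := by exact_mod_cast hδ
  have hτq : 0 < r.toRow.tau := hτ
  -- the three moment packages
  obtain ⟨hintL, hIL⟩ := integral_poly5 hτq r.toRowF.levPolyF (c := L) hL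
  obtain ⟨hintE, hIE⟩ := integral_poly5 hτq r.resPolyE (c := R) hE
  obtain ⟨hintO, hIO⟩ := integral_poly5_odd hτq r.resPolyO (c := o) hO
  have hτcast : ((r.toRow.tau : ℚ) : ℝ) = r.toRow.tauR := rfl
  rw [hτcast] at hintL hIL hintE hIE hintO hIO
  -- the exact residual integrand and its integral
  have hsum : Integrable (fun y : E3 => (1 + ‖y‖) ^ 5 * ‖lerayVorticityResidual r.toRow.field y‖ ^ 2) := by
    refine (hintE.add hintO).congr (Filter.Eventually.of_forall fun y => ?_)
    rw [Pi.add_apply]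
    beta_reduce
    rw [r.weight_mul_residual_eq hτ0 y]
  have hval : ∫ y, (1 + ‖y‖) ^ 5 * ‖lerayVorticityResidual r.toRow.field y‖ ^ 2 =
      ((R.1 + o : ℚ) : ℝ) * π + (R.2 : ℝ) * π ^ 2 := by
    have : (fun y : E3 => (1 + ‖y‖) ^ 5 * ‖lerayVorticityResidual r.toRow.field y‖ ^ 2) =
        fun y => Poly5.eval r.toRow.tauR r.resPolyE y + ‖y‖ * Poly5.eval r.toRow.tauR r.resPolyO y :=
      funext fun y => r.weight_mul_residual_eq hτ0 y
    rw [this, integral_add hintE hintO, hIE, hIO]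
    push_cast; ring
  refine ⟨r.toRow.field, r.toRow.contDiff_field, r.toRow.isDivFree_field, ?_, hsum, ?_⟩
  · -- LEVEL via the certified floor (as in v2)
    unfold lerayLevel
    refine (Real.le_sqrt hM' (integral_nonneg fun y => sq_nonneg _)).mpr ?_
    have hind : IntegrableOn (fun y => ‖curl r.toRow.field y‖ ^ 2) (ball (0 : E3) 10) := by
      have hc : Continuous fun y => ‖curl r.toRow.field y‖ ^ 2 := by
        have : (fun y => ‖curl r.toRow.field y‖ ^ 2) = fun y => ‖evalVec5 r.toRow.tauR r.toRow.om y‖ ^ 2 :=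
          funext fun y => by rw [r.toRow.curl_field y]
        rw [this]; exact (continuous_evalVec5 _ _).norm.pow 2
      exact (hc.continuousOn.integrableOn_compact (isCompact_closedBall (0 : E3) 10)).mono_set ball_subset_closedBall
    have hmono : ∫ y, Poly5.eval r.toRow.tauR r.toRowF.levPolyF y ≤ ∫ y in ball (0 : E3) 10, ‖curl r.toRow.field y‖ ^ 2 := by
      rw [← integral_indicator measurableSet_ball]
      refine integral_mono hintL (hind.integrable_indicator measurableSet_ball) fun y => ?_
      beta_reduce
      rw [show r.toRow.tauR = r.toRowF.toRow.tauR from rfl, r.toRowF.eval_levPolyF y, toRowF_toRow]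
      have key := FloorCert.floor_mul_le hτ r.floor hfloor y (sq_nonneg ‖curl r.toRow.field y‖)
      refine key.trans (le_of_eq ?_)
      by_cases hy : y ∈ ball (0 : E3) 10
      · rw [indicator_of_mem hy, indicator_of_mem hy, one_mul]
      · rw [indicator_of_notMem hy, indicator_of_notMem hy, zero_mul]
    have hlev' : (r.M : ℝ) ^ 2 ≤ (encLo L : ℝ) := by
      have := hlev; rw [← sq] at this; exact_mod_cast this
    calc (r.M : ℝ) ^ 2 ≤ (encLo L : ℝ) := hlev'
      _ ≤ (L.1 : ℝ) * π + (L.2 : ℝ) * π ^ 2 := encLo_le L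
      _ = ∫ y, Poly5.eval r.toRow.tauR r.toRowF.levPolyF y := hIL.symm
      _ ≤ ∫ y in ball (0 : E3) 10, ‖curl r.toRow.field y‖ ^ 2 := hmono
  · -- RESIDUAL: exact value, then the enclosure
    unfold lerayResidualNorm
    rw [show (r.δ : ℝ) = Real.sqrt ((r.δ : ℝ) ^ 2) by rw [Real.sqrt_sq hδ']]
    refine Real.sqrt_le_sqrt ?_
    have hres' : (encHi (R.1 + o, R.2) : ℝ) ≤ (r.δ : ℝ) ^ 2 := by
      have := hres; rw [← sq] at this; exact_mod_cast this
    calc ∫ y, (1 + ‖y‖) ^ 5 * ‖lerayVorticityResidual r.toRow.field y‖ ^ 2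
        = ((R.1 + o : ℚ) : ℝ) * π + (R.2 : ℝ) * π ^ 2 := hval
      _ ≤ (encHi (R.1 + o, R.2) : ℝ) := le_encHi (R.1 + o, R.2)
      _ ≤ (r.δ : ℝ) ^ 2 := hres'

end AlgRowG

/-- **Table soundness (v3)**: every row of a passing table certifies its `ForcedTsaiModulusLE M δ`. -/
theorem AlgTableG.sound (T : AlgTableG) (h : T.checkG = true) :
    ∀ r ∈ T, ForcedTsaiModulusLE (r.M : ℝ) (r.δ : ℝ) := by
  intro r hr
  unfold AlgTableG.checkG at h
  rw [List.all_eq_true] at h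
  exact r.sound (h r hr)

end Summit.NavierStokesRegularity.NavierStokesRegularity.Cruxes.ScarEnvelopeTypeI.ForcedTsai

end
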